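import Summits.ResolutionOfSingularities.ResolutionOfSingularities.Theorems.WeightedInvariantIota3Tau
import HarnessLib

/-!
# The P3 letter `τ` at the POSITIONS OF THE RUNG: `τ = 1 ↔ IsTiePosition` in Krull dimension `≤ 3`, the vanishing lemmas, and
# (strat-τ) — the top `ι₀ = (ν ; ε ; τ)`-stratum and its generic prime — door `HypersurfaceCentreConstruction`
# (stmt-ResolutionOfSingularities-19897), route `WeightedInvariant`, rung P3, ORDER (o40), sequel of `…WeightedInvariantIota3Tau`

[OURS · L1 W4.3 · cell `res-hironaka`, HUMAN RULING D-0089] Helper file `--supports stmt-ResolutionOfSingularities-19897`, res-type-013 on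
res-L1-w43-plan-1's ORDER (o40) (RULING gen 11 #2 (3) / #3; IOTA3-DESIGN v1.3 §8.1 «τ = 0 in dimension ≤ 2, at isolated / crossing / divisorial
positions, and at S_{P₀}», §8.2 «P₀ᵗ = 𝔪 at tie points, = P₀(ν ; ε) otherwise — lemma (strat-τ)», §8.5 (c7τ)/(strat-τ)).  Def-free.  CANDIDATE
DESIGN OBJECTS: nothing here is a statement of the manuscript under review (Hironaka 2017, [claim: Hironaka2017, status: under-review]); nothing
is attributed to its author; nothing here claims anything about resolution of singularities.  AI work, weaker than expert review.

## What is proved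

* §5 `isTieGenerization_iff_isTiePosition`, **`iotaTau_eq_one_iff_isTiePosition`** (local Noetherian, Krull dimension `≤ 3`: the saturated letter
  IS the raw tie bit — RULING gen 11 #3 (2) verbatim at every position of the rung), `iotaTau_of_isTiePosition`, `IsTiePosition.ne_zero`,
  `IsTiePosition.mem_maximalIdeal`, and the vanishing of `τ`: in Krull dimension `≤ 2`, at every proper generization of a position of dimension
  `≤ 3` (**(c7τ)≤3** of §8.5: `iotaTau_localization_eq_zero`), at CROSSING (`ε = 1`), ISOLATED (`P₀ = 𝔪`) and DIVISORIAL (`dim R ⧸ P₀ ≠ 1`)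
  positions, off dimension `3`; junk values `topStratum_iotaOrdEps_zero/_of_isUnit`, `iotaEps_zero`.
* §6 (strat-τ): `topStratum_iotaOrdEpsTau_eq_closedPoint_of_isTiePosition` (tie ⇒ the top `ι₀`-stratum is `{𝔪}`),
  `topStratum_iotaOrdEpsTau_eq_topStratum_iotaOrdEps` (no tie ⇒ it is the top `(ν ; ε)`-stratum), the ∃-form **`topStratum_iotaOrdEpsTau_eq`**
  and **`topStratumPrime_iotaOrdEpsTau_spec`** (res-type-078's p528738 one letter up: `P₀ᵗ` prime, `S ⧸ P₀ᵗ` regular, `f ∈ P₀ᵗ`, stratum `= V(P₀ᵗ)`,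
  `ι₀` kept exactly above `P₀ᵗ`, `f ∈ (P₀ᵗ)^ν`), and the two evaluations of `topStratumPrime iotaOrdEpsTau`.

## References

* H. Matsumura, *Commutative Ring Theory*, CUP 1986, §5 (dimension and height). [Matsumura1987]
* res-L1-w43-plan-1, `IOTA3-DESIGN.md` v1.3 §8 (OURS, AI planning); res-type-092 `…Iota3Tie` p531400; res-type-078 `…Iota3EpsStrat` p528033,
  `…Iota3EpsTopStratum` p528738 (OURS).
-/

noncomputable section

set_option linter.dupNamespace false -- mandated namespace `Summit.<Summit>.<Problem>` of this single-conjunct summit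

open IsLocalRing Literature.AlgebraicGeometry.Resolution
open Summit.ResolutionOfSingularities.ResolutionOfSingularities.Theorems
open Summit.ResolutionOfSingularities.ResolutionOfSingularities.Theorems.ContactCylinder (topStratum topStratumPrime iotaCylinder)

namespace Summit.ResolutionOfSingularities.ResolutionOfSingularities.Cruxes.HypersurfaceCentreConstruction.LocalEngine

namespace Iota3

/-! ## §5 The positions of the rung: `τ = 1 ↔ IsTiePosition` in Krull dimension `≤ 3`, and where `τ` vanishes -/

section Positions

variable {R : Type} [CommRing R]

/-- The structure isomorphism `R ≃+* R_𝔪` of a local ring (the complement of `𝔪` consists of units). [folklore] -/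
theorem exists_ringEquiv_atPrime_maximalIdeal (R : Type) [CommRing R] [IsLocalRing R] :
    ∃ e : R ≃+* Localization.AtPrime (maximalIdeal R),
      ∀ x, e x = algebraMap R (Localization.AtPrime (maximalIdeal R)) x :=
  ⟨RingEquiv.ofBijective _ (ContactCylinder.algebraMap_atPrime_maximalIdeal_bijective R), fun _ => rfl⟩

/-- A tie position is a tie generization (the closed point). [OURS] -/
theorem isTieGenerization_of_isTiePosition {f : R} (h : IsTiePosition R f) : IsTieGenerization R f := by
  haveI := h.isRegularLocalRing
  obtain ⟨e, he⟩ := exists_ringEquiv_atPrime_maximalIdeal R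
  refine ⟨closedPoint R, ?_⟩
  change IsTiePosition (Localization.AtPrime (maximalIdeal R)) (algebraMap R (Localization.AtPrime (maximalIdeal R)) f)
  rw [← he f]
  exact isTiePosition_of_ringEquiv e f h

/-- `τ = 1` at a tie position (any ring). [OURS] -/
theorem iotaTau_of_isTiePosition {f : R} (h : IsTiePosition R f) : iotaTau R f = 1 :=
  (iotaTau_eq_one_iff R f).mpr (isTieGenerization_of_isTiePosition h)

/-- A tie position has Krull dimension `3`. [OURS] -/
theorem ringKrullDim_eq_three_of_isTiePosition {f : R} (h : IsTiePosition R f) : ringKrullDim R = 3 := h.2.1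

/-- Junk argument `0`: `ε(R, 0) = 0` on a regular local ring (the top order stratum is everything `= V(⊥)`). [OURS] -/
theorem iotaEps_zero (R : Type) [CommRing R] [IsRegularLocalRing R] : iotaEps R 0 = 0 := by
  haveI := isDomain_of_isRegularLocalRing R
  rw [iotaEps_eq_zero_iff]
  refine ⟨⊥, inferInstance, IsRegularLocalRing.of_ringEquiv (RingEquiv.quotientBot R).symm, ?_⟩
  rw [ContactCylinder.topStratum_iotaOrd_zero]
  ext 𝔮
  simp

/-- Junk argument `0`: the top `(ν ; ε)`-stratum of `0` is everything (regular local ring). [OURS] -/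
theorem topStratum_iotaOrdEps_zero (R : Type) [CommRing R] [IsRegularLocalRing R] : topStratum iotaOrdEps R 0 = Set.univ := by
  refine Set.eq_univ_of_forall fun 𝔮 => ?_
  haveI : IsRegularLocalRing (Localization.AtPrime 𝔮.asIdeal) := isRegularLocalRing_localization_atPrime R _
  have hν := (ContactCylinder.mem_topStratum_iff iotaOrd R 0 𝔮).mp
    (by rw [ContactCylinder.topStratum_iotaOrd_zero]; trivial)
  rw [ContactCylinder.mem_topStratum_iff, iotaOrdEps_eq_iff]
  refine ⟨hν, ?_⟩
  rw [map_zero, iotaEps_zero, iotaEps_zero]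

/-- Junk argument a unit: the top `(ν ; ε)`-stratum is everything (regular local ring). [OURS] -/
theorem topStratum_iotaOrdEps_of_isUnit (R : Type) [CommRing R] [IsRegularLocalRing R] {f : R} (hf : IsUnit f) :
    topStratum iotaOrdEps R f = Set.univ := by
  refine Set.eq_univ_of_forall fun 𝔮 => ?_
  haveI : IsRegularLocalRing (Localization.AtPrime 𝔮.asIdeal) := isRegularLocalRing_localization_atPrime R _
  have hν := (ContactCylinder.mem_topStratum_iff iotaOrd R f 𝔮).mp
    (by rw [ContactCylinder.topStratum_iotaOrd_of_isUnit R hf]; trivial)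
  rw [ContactCylinder.mem_topStratum_iff, iotaOrdEps_eq_iff]
  refine ⟨hν, ?_⟩
  rw [iotaEps_of_isUnit (hf.map _), iotaEps_of_isUnit hf]

/-- When the top `(ν ; ε)`-stratum is everything, `dim R ⧸ P₀ = dim R` (`P₀ = ⊥`, `R` a domain). [OURS] -/
theorem ringKrullDim_quotient_topStratumPrime_of_topStratum_eq_univ (R : Type) [CommRing R] [IsDomain R] {f : R}
    (hE : topStratum iotaOrdEps R f = Set.univ) :
    ringKrullDim (R ⧸ topStratumPrime iotaOrdEps R f) = ringKrullDim R := by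
  rw [ContactCylinder.topStratumPrime_eq_bot_of_topStratum_eq_univ iotaOrdEps R f hE]
  exact (RingEquiv.quotientBot R).ringKrullDim

/-- A tie position has `f ≠ 0` (else `P₀ = ⊥` and `dim R ⧸ P₀ = 3 ≠ 1`). [OURS] -/
theorem IsTiePosition.ne_zero {f : R} (h : IsTiePosition R f) : f ≠ 0 := by
  obtain ⟨hreg, h3, -, h1, -⟩ := h
  rintro rfl
  haveI := isDomain_of_isRegularLocalRing R
  rw [ringKrullDim_quotient_topStratumPrime_of_topStratum_eq_univ R (topStratum_iotaOrdEps_zero R), h3] at h1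
  exact absurd h1 (by decide)

/-- A tie position has `f ∈ 𝔪` (else `f` is a unit, `P₀ = ⊥` and `dim R ⧸ P₀ = 3 ≠ 1`). [OURS] -/
theorem IsTiePosition.mem_maximalIdeal [IsLocalRing R] {f : R} (h : IsTiePosition R f) : f ∈ maximalIdeal R := by
  obtain ⟨hreg, h3, -, h1, -⟩ := h
  by_contra hf
  have hu : IsUnit f := by
    by_contra hnu
    exact hf ((IsLocalRing.mem_maximalIdeal f).mpr (mem_nonunits_iff.mpr hnu))
  haveI := isDomain_of_isRegularLocalRing R
  rw [ringKrullDim_quotient_topStratumPrime_of_topStratum_eq_univ R (topStratum_iotaOrdEps_of_isUnit R hu), h3] at h1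
  exact absurd h1 (by decide)

/-- The Krull dimension of a localisation at a prime does not exceed that of the ring. [cite: Matsumura1987, §5] -/
theorem ringKrullDim_localization_atPrime_le (𝔭 : Ideal R) [𝔭.IsPrime] :
    ringKrullDim (Localization.AtPrime 𝔭) ≤ ringKrullDim R := by
  rw [IsLocalization.AtPrime.ringKrullDim_eq_height 𝔭 (Localization.AtPrime 𝔭)]
  exact Ideal.height_le_ringKrullDim_of_isPrime

/-- **No tie generization in Krull dimension `≤ 2`** (every localisation has dimension `≤ 2 ≠ 3`). [OURS] -/
theorem not_isTieGenerization_of_ringKrullDim_le_two (hdim : ringKrullDim R ≤ 2) (f : R) : ¬ IsTieGenerization R f := by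
  rintro ⟨𝔭, h𝔭⟩
  have h3 := ringKrullDim_eq_three_of_isTiePosition h𝔭
  have hle := (ringKrullDim_localization_atPrime_le 𝔭.asIdeal).trans hdim
  rw [h3] at hle
  exact absurd hle (by decide)

/-- `τ = 0` in Krull dimension `≤ 2` (any ring). [OURS · §8.1 «τ = 0 in dimension ≤ 2»] -/
theorem iotaTau_eq_zero_of_ringKrullDim_le_two (hdim : ringKrullDim R ≤ 2) (f : R) : iotaTau R f = 0 :=
  (iotaTau_eq_zero_iff R f).mpr (not_isTieGenerization_of_ringKrullDim_le_two hdim f)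

/-- **(c7τ) of §8.5: a PROPER generization of a position of Krull dimension `≤ 3` is never a tie**: for a local Noetherian
`R` with `dim R ≤ 3` and a prime `𝔭 ≠ 𝔪`, `τ(R_𝔭, f) = 0` (`dim R_𝔭 ≤ 2`, res-type-078 p528033). [OURS] -/
theorem iotaTau_localization_eq_zero [IsLocalRing R] [IsNoetherianRing R] (hdim : ringKrullDim R ≤ 3) (𝔭 : Ideal R)
    [𝔭.IsPrime] (h𝔭 : 𝔭 ≠ maximalIdeal R) (f : R) :
    iotaTau (Localization.AtPrime 𝔭) (algebraMap R (Localization.AtPrime 𝔭) f) = 0 :=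
  iotaTau_eq_zero_of_ringKrullDim_le_two (ringKrullDim_localization_le_two_of_ne hdim 𝔭 h𝔭) _

/-- **At a position of the rung the letter is the raw bit**: for a local Noetherian `R` of Krull dimension `≤ 3`,
`IsTieGenerization R f ↔ IsTiePosition R f`. [OURS · §8.1 verbatim at dim ≤ 3] -/
theorem isTieGenerization_iff_isTiePosition [IsLocalRing R] [IsNoetherianRing R] (hdim : ringKrullDim R ≤ 3) (f : R) :
    IsTieGenerization R f ↔ IsTiePosition R f := by
  refine ⟨fun ⟨𝔭, h𝔭⟩ => ?_, isTieGenerization_of_isTiePosition⟩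
  by_cases hne : 𝔭.asIdeal = maximalIdeal R
  · obtain ⟨e, he⟩ := exists_ringEquiv_atPrime_maximalIdeal R
    have key : ∀ (X : Ideal R) [X.IsPrime], X = maximalIdeal R →
        IsTiePosition (Localization.AtPrime X) (algebraMap R (Localization.AtPrime X) f) → IsTiePosition R f := by
      rintro X _ rfl hX
      rw [← he f] at hX
      exact (isTiePosition_ringEquiv_iff e f).mp hX
    exact key 𝔭.asIdeal hne h𝔭
  · have h0 := iotaTau_localization_eq_zero hdim 𝔭.asIdeal hne f
    rw [iotaTau_of_isTiePosition h𝔭] at h0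
    exact absurd h0 one_ne_zero

/-- **`τ(R, f) = 1 ↔ IsTiePosition R f`** at every local Noetherian position of Krull dimension `≤ 3`. [OURS · §8.1 verbatim] -/
theorem iotaTau_eq_one_iff_isTiePosition [IsLocalRing R] [IsNoetherianRing R] (hdim : ringKrullDim R ≤ 3) (f : R) :
    iotaTau R f = 1 ↔ IsTiePosition R f :=
  (iotaTau_eq_one_iff R f).trans (isTieGenerization_iff_isTiePosition hdim f)

/-- `τ(R, f) = 0 ↔ ¬ IsTiePosition R f` at every local Noetherian position of Krull dimension `≤ 3`. [OURS] -/
theorem iotaTau_eq_zero_iff_not_isTiePosition [IsLocalRing R] [IsNoetherianRing R] (hdim : ringKrullDim R ≤ 3) (f : R) :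
    iotaTau R f = 0 ↔ ¬ IsTiePosition R f :=
  (iotaTau_eq_zero_iff R f).trans (not_congr (isTieGenerization_iff_isTiePosition hdim f))

/-- `τ = 0` at a CROSSING position (`ε = 1`) of Krull dimension `≤ 3`. [OURS · §8.1] -/
theorem iotaTau_eq_zero_of_iotaEps_eq_one [IsLocalRing R] [IsNoetherianRing R] (hdim : ringKrullDim R ≤ 3) {f : R}
    (hε : iotaEps R f = 1) : iotaTau R f = 0 := by
  rw [iotaTau_eq_zero_iff_not_isTiePosition hdim]
  rintro ⟨_, -, h0, -⟩
  rw [hε] at h0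
  exact one_ne_zero h0

/-- `τ = 0` when the top `(ν ; ε)`-stratum is not a curve (`dim R ⧸ P₀ ≠ 1`: ISOLATED and DIVISORIAL positions), Krull dimension
`≤ 3`. [OURS · §8.1] -/
theorem iotaTau_eq_zero_of_ringKrullDim_quotient_ne_one [IsLocalRing R] [IsNoetherianRing R] (hdim : ringKrullDim R ≤ 3)
    {f : R} (h : ringKrullDim (R ⧸ topStratumPrime iotaOrdEps R f) ≠ 1) : iotaTau R f = 0 := by
  rw [iotaTau_eq_zero_iff_not_isTiePosition hdim]
  rintro ⟨_, -, -, h1, -⟩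
  exact h h1

/-- `τ = 0` at an ISOLATED position (`P₀ = 𝔪`), Krull dimension `≤ 3`. [OURS · §8.1] -/
theorem iotaTau_eq_zero_of_topStratumPrime_eq_maximalIdeal [IsLocalRing R] [IsNoetherianRing R]
    (hdim : ringKrullDim R ≤ 3) {f : R} (h : topStratumPrime iotaOrdEps R f = maximalIdeal R) : iotaTau R f = 0 := by
  refine iotaTau_eq_zero_of_ringKrullDim_quotient_ne_one hdim ?_
  rw [h]
  have hF : IsField (R ⧸ maximalIdeal R) :=
    (Ideal.Quotient.maximal_ideal_iff_isField_quotient (maximalIdeal R)).mp inferInstance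
  letI := hF.toField
  rw [ringKrullDim_eq_zero_of_field]
  exact zero_ne_one

/-- `τ = 0` off Krull dimension `3` (local Noetherian positions of dimension `≤ 3`). [OURS] -/
theorem iotaTau_eq_zero_of_ringKrullDim_ne_three [IsLocalRing R] [IsNoetherianRing R] (hdim : ringKrullDim R ≤ 3)
    (h3 : ringKrullDim R ≠ 3) (f : R) : iotaTau R f = 0 := by
  rw [iotaTau_eq_zero_iff_not_isTiePosition hdim]
  exact fun h => h3 (ringKrullDim_eq_three_of_isTiePosition h)

end Positions

/-! ## §6 (strat-τ): the top `ι₀`-stratum and its generic prime -/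

section Strat

variable {S : Type} [CommRing S]

/-- At the closed point nothing changes for the stratifier: `ι₀ (S_𝔪) (f/1) = ι₀ S f`. [OURS] -/
theorem iotaOrdEpsTau_localization_maximalIdeal_eq [IsLocalRing S] (f : S) :
    iotaOrdEpsTau (Localization.AtPrime (maximalIdeal S)) (algebraMap S (Localization.AtPrime (maximalIdeal S)) f) =
      iotaOrdEpsTau S f :=
  LocalGameEFT4SDimOne.iota_localization_maximalIdeal_eq iotaOrdEpsTau iotaOrdEpsTau_isoInvariant f

/-- A prime lies on the top `ι₀`-stratum iff it lies on the top `(ν ; ε)`-stratum and keeps `τ`. [OURS] -/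
theorem mem_topStratum_iotaOrdEpsTau_iff (f : S) (𝔮 : PrimeSpectrum S) :
    𝔮 ∈ topStratum iotaOrdEpsTau S f ↔
      𝔮 ∈ topStratum iotaOrdEps S f ∧
        iotaTau (Localization.AtPrime 𝔮.asIdeal) (algebraMap S (Localization.AtPrime 𝔮.asIdeal) f) = iotaTau S f := by
  rw [ContactCylinder.mem_topStratum_iff, ContactCylinder.mem_topStratum_iff, iotaOrdEpsTau_eq_iff]

/-- **(strat-τ), tie case: the top `ι₀`-stratum of a TIE position is the closed point** (a proper generization has `τ = 0 < 1`).
[OURS · §8.2 «P₀ᵗ = 𝔪 at tie points»] -/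
theorem topStratum_iotaOrdEpsTau_eq_closedPoint_of_isTiePosition [IsLocalRing S] {f : S} (h : IsTiePosition S f) :
    topStratum iotaOrdEpsTau S f = {𝔮 | maximalIdeal S ≤ 𝔮.asIdeal} := by
  haveI := h.isRegularLocalRing
  have hdim : ringKrullDim S ≤ 3 := le_of_eq (ringKrullDim_eq_three_of_isTiePosition h)
  ext 𝔮
  rw [Set.mem_setOf_eq]
  constructor
  · intro h𝔮
    by_contra hne
    have hne' : 𝔮.asIdeal ≠ maximalIdeal S := fun heq => hne (le_of_eq heq.symm)
    have hτ := ((mem_topStratum_iotaOrdEpsTau_iff f 𝔮).mp h𝔮).2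
    rw [iotaTau_localization_eq_zero hdim 𝔮.asIdeal hne' f, iotaTau_of_isTiePosition h] at hτ
    exact zero_ne_one hτ
  · intro hle
    have heq : 𝔮 = closedPoint S :=
      PrimeSpectrum.ext ((IsLocalRing.maximalIdeal.isMaximal S).eq_of_le 𝔮.isPrime.ne_top hle).symm
    rw [heq]
    exact ContactCylinder.closedPoint_mem_topStratum iotaOrdEpsTau_isoInvariant S f

/-- **(strat-τ), no-tie case: off tie positions the top `ι₀`-stratum is the top `(ν ; ε)`-stratum** (local Noetherian, Krull
dimension `≤ 3`: `τ = 0` at the position and at every generization). [OURS · §8.2 «P₀ᵗ = P₀(ν ; ε) otherwise»] -/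
theorem topStratum_iotaOrdEpsTau_eq_topStratum_iotaOrdEps [IsLocalRing S] [IsNoetherianRing S] (hdim : ringKrullDim S ≤ 3)
    {f : S} (h : ¬ IsTiePosition S f) : topStratum iotaOrdEpsTau S f = topStratum iotaOrdEps S f := by
  ext 𝔮
  rw [mem_topStratum_iotaOrdEpsTau_iff]
  refine ⟨fun h𝔮 => h𝔮.1, fun h𝔮 => ⟨h𝔮, ?_⟩⟩
  rw [(iotaTau_eq_zero_iff_not_isTiePosition hdim f).mpr h]
  exact le_antisymm ((iotaTau_localization_le 𝔮.asIdeal f).trans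
    (le_of_eq ((iotaTau_eq_zero_iff_not_isTiePosition hdim f).mpr h))) zero_le

/-- The generic primes agree when the strata do. [folklore] -/
theorem topStratumPrime_congr {ι₁ ι₂ : (R : Type) → [CommRing R] → R → Ordinal.{0}} {f : S}
    (h : topStratum ι₁ S f = topStratum ι₂ S f) : topStratumPrime ι₁ S f = topStratumPrime ι₂ S f := by
  unfold ContactCylinder.topStratumPrime
  rw [h]

/-- `P₀ᵗ = 𝔪` at a tie position. [OURS · §8.2] -/
theorem topStratumPrime_iotaOrdEpsTau_eq_maximalIdeal_of_isTiePosition [IsLocalRing S] {f : S} (h : IsTiePosition S f) :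
    topStratumPrime iotaOrdEpsTau S f = maximalIdeal S :=
  ContactCylinder.topStratumPrime_eq_maximalIdeal_of_topStratum_eq iotaOrdEpsTau S f
    (topStratum_iotaOrdEpsTau_eq_closedPoint_of_isTiePosition h)

/-- `P₀ᵗ = P₀(ν ; ε)` off tie positions (local Noetherian, Krull dimension `≤ 3`). [OURS · §8.2] -/
theorem topStratumPrime_iotaOrdEpsTau_eq_of_not_isTiePosition [IsLocalRing S] [IsNoetherianRing S]
    (hdim : ringKrullDim S ≤ 3) {f : S} (h : ¬ IsTiePosition S f) :
    topStratumPrime iotaOrdEpsTau S f = topStratumPrime iotaOrdEps S f :=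
  topStratumPrime_congr (topStratum_iotaOrdEpsTau_eq_topStratum_iotaOrdEps hdim h)

/-- **(strat-τ) THE TOP `ι₀`-STRATUM AT A P3 POSITION IS A PERMISSIBLE CENTRE**: for `S` regular local of Krull dimension `≤ 3`
and `0 ≠ f ∈ 𝔪` there is a prime `P ∋ f` with `S ⧸ P` regular and `topStratum iotaOrdEpsTau S f = V(P)` (`P = 𝔪` at tie positions,
res-type-078's `P` of `topStratum_iotaOrdEps_eq` otherwise). [OURS · L1 W4.3, kernel] -/
theorem topStratum_iotaOrdEpsTau_eq [IsRegularLocalRing S] (hdim : ringKrullDim S ≤ 3) {f : S} (hf0 : f ≠ 0)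
    (hf : f ∈ maximalIdeal S) :
    ∃ P : Ideal S, P.IsPrime ∧ IsRegularLocalRing (S ⧸ P) ∧ f ∈ P ∧
      topStratum iotaOrdEpsTau S f = {𝔮 | P ≤ 𝔮.asIdeal} := by
  by_cases h : IsTiePosition S f
  · refine ⟨maximalIdeal S, inferInstance, ?_, hf, topStratum_iotaOrdEpsTau_eq_closedPoint_of_isTiePosition h⟩
    have hF : IsField (S ⧸ maximalIdeal S) :=
      (Ideal.Quotient.maximal_ideal_iff_isField_quotient (maximalIdeal S)).mp inferInstance
    letI := hF.toField
    infer_instance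
  · obtain ⟨P, hP, hreg, hfP, hE⟩ := topStratum_iotaOrdEps_eq hdim hf0 hf
    exact ⟨P, hP, hreg, hfP, (topStratum_iotaOrdEpsTau_eq_topStratum_iotaOrdEps hdim h).trans hE⟩

/-- **(strat-τ) THE GENERIC PRIME OF THE TOP `ι₀`-STRATUM AT A P3 POSITION**: `P₀ᵗ := topStratumPrime iotaOrdEpsTau S f` is prime,
`S ⧸ P₀ᵗ` is a regular local ring, `f ∈ P₀ᵗ`, the stratum is `V(P₀ᵗ)`, the stratifier is kept exactly at the primes above `P₀ᵗ`,
and `f ∈ (P₀ᵗ) ^ ν` (`ν = ord f`) — res-type-078's `topStratumPrime_iotaOrdEps_spec` (p528738) one letter up; the hypotheses the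
cylinder combinators `jCylinder` / `iotaCylinder` take at `ι₀`. [OURS · L1 W4.3, kernel] -/
theorem topStratumPrime_iotaOrdEpsTau_spec [IsRegularLocalRing S] (hdim : ringKrullDim S ≤ 3) {f : S} (hf0 : f ≠ 0)
    (hf : f ∈ maximalIdeal S) {ν : ℕ} (hν : iotaOrd S f = ν) :
    ∃ (_ : (topStratumPrime iotaOrdEpsTau S f).IsPrime),
      IsRegularLocalRing (S ⧸ topStratumPrime iotaOrdEpsTau S f) ∧
      f ∈ topStratumPrime iotaOrdEpsTau S f ∧
      topStratum iotaOrdEpsTau S f = {𝔮 | topStratumPrime iotaOrdEpsTau S f ≤ 𝔮.asIdeal} ∧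
      (∀ (𝔭 : Ideal S) [𝔭.IsPrime], f ∈ 𝔭 →
        (iotaOrdEpsTau (Localization.AtPrime 𝔭) (algebraMap S (Localization.AtPrime 𝔭) f) = iotaOrdEpsTau S f ↔
          topStratumPrime iotaOrdEpsTau S f ≤ 𝔭)) ∧
      f ∈ topStratumPrime iotaOrdEpsTau S f ^ ν := by
  obtain ⟨P, hP, hreg, hfP, hS⟩ := topStratum_iotaOrdEpsTau_eq hdim hf0 hf
  have hP₀ : topStratumPrime iotaOrdEpsTau S f = P := ContactCylinder.topStratumPrime_eq_of_topStratum_eq iotaOrdEpsTau S f hS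
  rw [hP₀]
  have hiff : ∀ (𝔭 : Ideal S) [𝔭.IsPrime], f ∈ 𝔭 →
      (iotaOrdEpsTau (Localization.AtPrime 𝔭) (algebraMap S (Localization.AtPrime 𝔭) f) = iotaOrdEpsTau S f ↔ P ≤ 𝔭) := by
    intro 𝔭 _ _
    have := Set.ext_iff.mp hS ⟨𝔭, inferInstance⟩
    rwa [ContactCylinder.mem_topStratum_iff, Set.mem_setOf_eq] at this
  have hord : iotaOrd (Localization.AtPrime P) (algebraMap S (Localization.AtPrime P) f) = iotaOrd S f :=
    ((iotaOrdEps_eq_iff _ _ _ _).mp ((iotaOrdEpsTau_eq_iff _ _ _ _).mp ((hiff P hfP).mpr le_rfl)).1).1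
  haveI := hreg
  exact ⟨hP, hreg, hfP, hS, fun 𝔭 _ h => hiff 𝔭 h, EquimultipleCentre.mem_pow_of_iotaOrd_localization_eq P hν hord⟩

end Strat

end Iota3

end Summit.ResolutionOfSingularities.ResolutionOfSingularities.Cruxes.HypersurfaceCentreConstruction.LocalEngine

end
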